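import Summits.CriticalPhenomena.CardyFormulaZ2.Theorems.CardyComplexConeEdgePrecompactUFRSJunctionFunnelCore
import Summits.CriticalPhenomena.CardyFormulaZ2.Theorems.CardyComplexConeEdgePrecompactUFRSRectArcNear

/-!
# The junction funnel, part D: the reference frame (transport of corners, orbits and inner faces)
(line `qkz-strip-boundary-arm` of crux `CardyComplexCone.EdgePrecompact`, stmt-CriticalPhenomena-11387;
fourth file of the registered sub-goal S2 = `ufrs_junctionFunnel`, lead c5, wave 4; registered
anchor `cornerOrbit_frame_JF`)

The abstract funnel (`…UFRSJunctionFunnelCore.lean`) lives in the reference frame of the gate: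
the junction at the origin, the domain above the boundary row. A physical junction (any side or
corner of the lattice box, either chirality) is brought there by an ORIENTATION-PRESERVING frame
`ψ = σ ∘ (· - n)`, `σ = Site.signedPerm π ε` a rotation, i.e. `σ (cornerUnit k) = cornerUnit (k + j)`
for a fixed `j : Fin 4` (hypothesis `hrot`; chirality is handled by mirroring the gate, not the
frame, because Smirnov's successor map is chiral). This file transports the medial bookkeeping
along such a frame:

* `signedPerm_decomp_JF`, `frame_coord_JF` — coordinates of `σ u` (`= u₀ σe₀ + u₁ σe₁`);
* `nextCorner_frame_JF`, `cornerOrbit_frame_JF` (registered anchor) — the corner map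
  `(v, k) ↦ (σ (v - n), k + j)` conjugates `nextCorner β` to `nextCorner (ψ '' β)` and hence maps
  orbits to orbits (`cTgt` is equivariant and `ψ '' β ∋ ψ e ↔ β ∋ e`);
* `corners_mem_of_isInnerFace_JF`, `refFace_of_corners_JF` — an inner face of rectangle data has
  its four corners `v, v + u_k, v + u_{k+1}, v + u_k + u_{k+1}` in the lattice box, and four such
  corners in a reference box make `cFace` a face of that box (so inner faces transport);
* `exists_firstExit_JF` — the prefix of a walk up to its first vertex outside a set (used to
  truncate the arch of the gate at the boundary of the box).

References: S. Smirnov, C. R. Acad. Sci. Paris 333 (2001), §2; G. Grimmett, *Percolation* (1999),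
§11.2 (lattice symmetries).
-/

set_option linter.unusedVariables false

namespace Summit.CriticalPhenomena.CardyFormulaZ2.Cruxes.EdgePrecompact.QkzStripBoundaryArm

open MeasureTheory Filter Set Metric
open scoped Topology BigOperators Pointwise
open Literature.Probability.LatticeModels Literature.Probability.Percolation
open Literature.Probability.RandomPlanarGeometry (DobrushinDomain)
open Summit.CriticalPhenomena.CardyFormulaZ2.Theses.CardyComplexCone

noncomputable section

/-! ## Coordinates of the frame -/

/-- A signed permutation is determined by the images of the two unit vectors:
`σ u = u₀ σ e₀ + u₁ σ e₁`, in coordinates. -/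
theorem signedPerm_decomp_JF (π : Equiv.Perm (Fin 2)) (ε : Fin 2 → ℤˣ) (u : Site 2) (i : Fin 2) :
    Site.signedPerm π ε u i = u 0 * Site.signedPerm π ε (cornerUnit 0) i + u 1 * Site.signedPerm π ε (cornerUnit 1) i := by
  have h2 : ∀ t : Fin 2, t = 0 ∨ t = 1 := by decide
  simp only [Site.signedPerm_apply]
  rcases h2 (π.symm i) with h | h <;> rw [h] <;> simp [cornerUnit] <;> ring

/-- The frame map on the unit vectors of `x + u`: `σ (x + u_k - n) = σ (x - n) + u_{k+j}`. -/
theorem frame_add_cornerUnit_JF {π : Equiv.Perm (Fin 2)} {ε : Fin 2 → ℤˣ} {j : Fin 4}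
    (hrot : ∀ k, Site.signedPerm π ε (cornerUnit k) = cornerUnit (k + j)) (n x : Site 2) (k : Fin 4) :
    Site.signedPerm π ε (x + cornerUnit k - n) = Site.signedPerm π ε (x - n) + cornerUnit (k + j) := by
  rw [show x + cornerUnit k - n = (x - n) + cornerUnit k by abel, Site.signedPerm_add, hrot]

/-- **Coordinates of a rotation frame**: `σ u = u₀ u_j + u₁ u_{j+1}` in coordinates. Combined with
the `D4` table `corner_coord_JF j` this expresses `σ u` as `(u₀, u₁)`, `(-u₁, u₀)`, `(-u₀, -u₁)` or
`(u₁, -u₀)`. -/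
theorem frame_coord_JF {π : Equiv.Perm (Fin 2)} {ε : Fin 2 → ℤˣ} {j : Fin 4}
    (hrot : ∀ k, Site.signedPerm π ε (cornerUnit k) = cornerUnit (k + j)) (u : Site 2) :
    Site.signedPerm π ε u 0 = u 0 * cornerUnit j 0 + u 1 * cornerUnit (j + 1) 0 ∧
      Site.signedPerm π ε u 1 = u 0 * cornerUnit j 1 + u 1 * cornerUnit (j + 1) 1 := by
  have h0 : Site.signedPerm π ε (cornerUnit 0) = cornerUnit j := by rw [hrot, zero_add]
  have h1 : Site.signedPerm π ε (cornerUnit 1) = cornerUnit (j + 1) := by rw [hrot, add_comm]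
  constructor <;> rw [signedPerm_decomp_JF, h0, h1]

/-- The frame as a graph automorphism: `((zdShiftIso (-n)).trans (zdSignedPermIso π ε)) x = σ (x - n)`. -/
theorem frame_apply_JF (π : Equiv.Perm (Fin 2)) (ε : Fin 2 → ℤˣ) (n x : Site 2) :
    ((zdShiftIso (-n)).trans (zdSignedPermIso π ε)) x = Site.signedPerm π ε (x - n) := by
  rw [sub_eq_add_neg]; rfl

/-! ## Transport of the successor map and of orbits -/

/-- **The successor map is equivariant under rotation frames.** With `ψ = σ ∘ (· - n)` and the
corner map `(v, k) ↦ (σ (v - n), k + j)`: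
`nextCorner (ψ '' β) (σ (v - n), k + j) = (σ (v' - n), k' + j)` where `(v', k') = nextCorner β (v, k)`. -/
theorem nextCorner_frame_JF {π : Equiv.Perm (Fin 2)} {ε : Fin 2 → ℤˣ} {j : Fin 4}
    (hrot : ∀ k, Site.signedPerm π ε (cornerUnit k) = cornerUnit (k + j)) (n : Site 2) (β : BondConfig (Site 2))
    (c : Site 2 × Fin 4) :
    nextCorner (BondConfig.relabel (sym2Equiv ((zdShiftIso (-n)).trans (zdSignedPermIso π ε)).toEquiv) β)
        (Site.signedPerm π ε (c.1 - n), c.2 + j) =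
      (Site.signedPerm π ε ((nextCorner β c).1 - n), (nextCorner β c).2 + j) := by
  have key : cTgt (Site.signedPerm π ε (c.1 - n), c.2 + j) ∈
      BondConfig.relabel (sym2Equiv ((zdShiftIso (-n)).trans (zdSignedPermIso π ε)).toEquiv) β ↔ cTgt c ∈ β := by
    rw [cTgt, cTgt]
    dsimp only
    rw [show c.2 + j + 1 = (c.2 + 1) + j from add_right_comm _ _ _, ← frame_add_cornerUnit_JF hrot, ← frame_apply_JF π ε n,
      ← frame_apply_JF π ε n, mk_mem_relabel_iso_iff]
  by_cases h : cTgt c ∈ β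
  · rw [nextCorner_of_mem (key.2 h), nextCorner_of_mem h]
    dsimp only
    rw [Prod.mk.injEq]
    refine ⟨?_, add_right_comm _ _ _⟩
    rw [show c.2 + j + 1 = (c.2 + 1) + j from add_right_comm _ _ _, ← frame_add_cornerUnit_JF hrot]
  · rw [nextCorner_of_not_mem (fun h' => h (key.1 h')), nextCorner_of_not_mem h]
    dsimp only
    rw [Prod.mk.injEq]
    exact ⟨rfl, add_right_comm _ _ _⟩

/-- **Orbits transport along rotation frames** (registered anchor `cornerOrbit_frame_JF` of
stmt-CriticalPhenomena-11387): the orbit of `(σ (v - n), k + j)` under `nextCorner (ψ '' β)` is the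
image of the orbit of `(v, k)` under `nextCorner β`. -/
theorem cornerOrbit_frame_JF : ∀ (π : Equiv.Perm (Fin 2)) (ε : Fin 2 → ℤˣ) (j : Fin 4) (n : Site 2) (β : BondConfig (Site 2)) (c : Site 2 × Fin 4) (t : ℕ), (∀ k, Site.signedPerm π ε (cornerUnit k) = cornerUnit (k + j)) → cornerOrbit (BondConfig.relabel (sym2Equiv ((zdShiftIso (-n)).trans (zdSignedPermIso π ε)).toEquiv) β) (Site.signedPerm π ε (c.1 - n), c.2 + j) t = (Site.signedPerm π ε ((cornerOrbit β c t).1 - n), (cornerOrbit β c t).2 + j) := by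
  intro π ε j n β c t hrot
  induction t with
  | zero => rfl
  | succ t ih =>
    show nextCorner _ (cornerOrbit _ _ t) = _
    rw [ih, nextCorner_frame_JF hrot]
    rfl

/-! ## Transport of inner faces -/

/-- The opposite corner of the face of a corner: `v + u_k + u_{k+1}` is a corner of `cFace (v, k)`. -/
theorem isCorner_opposite_JF (v : Site 2) (k : Fin 4) :
    Literature.Probability.LatticeModels.IsCorner (v + cornerUnit k + cornerUnit (k + 1)) (cFace (v, k)) := by
  intro i
  simp only [cFace, faceAt, Pi.add_apply, Pi.sub_apply]
  rcases corner_coord_JF k with h | h | h | h <;> fin_cases i <;>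
    simp only [Fin.zero_eta, Fin.mk_one, Fin.isValue] <;> omega

/-- **Inner faces of rectangle data have their four corners in the lattice box**: for
`ℤ²`-admissible data of an open rectangle, if `cFace (v, k)` is an inner face then `v`, `v + u_k`,
`v + u_{k+1}`, `v + u_k + u_{k+1}` are mesh vertices. -/
theorem corners_mem_of_isInnerFace_JF {F : DiscreteDobrushin} {x₀ x₁ y₀ y₁ : ℝ} (hF : F.IsZdAdmissible)
    (hFΩ : F.Ω = Set.Ioo x₀ x₁ ×ℂ Set.Ioo y₀ y₁) {v : Site 2} {k : Fin 4} (h : F.IsInnerFace (cFace (v, k))) :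
    v ∈ meshVertices F.Ω F.δ ∧ v + cornerUnit k ∈ meshVertices F.Ω F.δ ∧
      v + cornerUnit (k + 1) ∈ meshVertices F.Ω F.δ ∧ v + cornerUnit k + cornerUnit (k + 1) ∈ meshVertices F.Ω F.δ := by
  have hc0 : Literature.Probability.LatticeModels.IsCorner v (cFace (v, k)) := isCorner_cFace (v, k)
  have hc1 : Literature.Probability.LatticeModels.IsCorner (v + cornerUnit k) (cFace (v, k)) :=
    (isCorner_add_faceAt_iff v k k).2 (Or.inl rfl)
  have hc2 : Literature.Probability.LatticeModels.IsCorner (v + cornerUnit (k + 1)) (cFace (v, k)) :=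
    (isCorner_add_faceAt_iff v (k + 1) k).2 (Or.inr (fin4_add_one_add_three k).symm)
  have hc3 := isCorner_opposite_JF v k
  have ha1 : (zdGraph 2).Adj v (v + cornerUnit k) := by
    rw [adj_iff_coord_JF]; simp only [Pi.add_apply]
    rcases corner_coord_JF k with h | h | h | h <;> omega
  have ha2 : (zdGraph 2).Adj (v + cornerUnit (k + 1)) (v + cornerUnit k + cornerUnit (k + 1)) := by
    rw [adj_iff_coord_JF]; simp only [Pi.add_apply]
    rcases corner_coord_JF k with h | h | h | h <;> omega
  have h1 := (dom_adj_iff_rect hF hFΩ).1 (h _ _ hc0 hc1 ha1)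
  have h2 := (dom_adj_iff_rect hF hFΩ).1 (h _ _ hc2 hc3 ha2)
  exact ⟨h1.2.1, h1.2.2, h2.2.1, h2.2.2⟩

/-- **Four corners in a box make the face a face of the box** (reference side of the transport
of inner faces). -/
theorem refFace_of_corners_JF (I₀ I₁ J₀ J₁ : ℤ) (w : Site 2) (m : Fin 4)
    (h0 : I₀ ≤ w 0 ∧ w 0 ≤ I₁ ∧ J₀ ≤ w 1 ∧ w 1 ≤ J₁)
    (h1 : I₀ ≤ (w + cornerUnit m) 0 ∧ (w + cornerUnit m) 0 ≤ I₁ ∧ J₀ ≤ (w + cornerUnit m) 1 ∧ (w + cornerUnit m) 1 ≤ J₁)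
    (h2 : I₀ ≤ (w + cornerUnit (m + 1)) 0 ∧ (w + cornerUnit (m + 1)) 0 ≤ I₁ ∧
      J₀ ≤ (w + cornerUnit (m + 1)) 1 ∧ (w + cornerUnit (m + 1)) 1 ≤ J₁) :
    I₀ ≤ cFace (w, m) 0 ∧ cFace (w, m) 0 + 1 ≤ I₁ ∧ J₀ ≤ cFace (w, m) 1 ∧ cFace (w, m) 1 + 1 ≤ J₁ := by
  simp only [cFace, faceAt, Pi.add_apply, Pi.sub_apply] at h1 h2 ⊢
  rcases corner_coord_JF m with h | h | h | h <;> omega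

/-! ## The prefix of a walk up to its first exit from a set -/

/-- **First exit.** If the last vertex of a walk lies outside a set `S` (a predicate), the walk has
a prefix ending at its first vertex outside `S`: all dart sources of the prefix lie in `S`, its
darts and vertices are darts and vertices of the walk. -/
theorem exists_firstExit_JF {V : Type*} {G : SimpleGraph V} (S : V → Prop) :
    ∀ {a b : V} (p : G.Walk a b), ¬ S b →
      ∃ (c : V) (q : G.Walk a c), ¬ S c ∧ (∀ d ∈ q.darts, S d.fst) ∧ (∀ d ∈ q.darts, d ∈ p.darts) ∧
        (∀ z ∈ q.support, z ∈ p.support) := by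
  classical
  intro a b p
  induction p with
  | nil =>
    intro hb
    exact ⟨_, SimpleGraph.Walk.nil, hb, by simp, by simp, by simp⟩
  | cons h p ih =>
    rename_i x y z
    intro hb
    by_cases hx : S x
    · obtain ⟨c, q, hc, hS, hd, hs⟩ := ih hb
      refine ⟨c, SimpleGraph.Walk.cons h q, hc, ?_, ?_, ?_⟩
      · intro d hd'
        simp only [SimpleGraph.Walk.darts_cons, List.mem_cons] at hd'
        rcases hd' with rfl | hd'
        · exact hx
        · exact hS d hd'
      · intro d hd'
        simp only [SimpleGraph.Walk.darts_cons, List.mem_cons] at hd' ⊢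
        rcases hd' with rfl | hd'
        · exact Or.inl rfl
        · exact Or.inr (hd d hd')
      · intro w hw
        simp only [SimpleGraph.Walk.support_cons, List.mem_cons] at hw ⊢
        rcases hw with rfl | hw
        · exact Or.inl rfl
        · exact Or.inr (hs w hw)
    · exact ⟨x, SimpleGraph.Walk.nil, hx, by simp, by simp, by simp⟩

end

end Summit.CriticalPhenomena.CardyFormulaZ2.Cruxes.EdgePrecompact.QkzStripBoundaryArm
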